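import Literature.MathematicalPhysics.QuantumLattice.DWaveSourceTorusComplexSourceDisc
import Literature.MathematicalPhysics.QuantumLattice.ApproximatingHamiltonianProofs
import HarnessLib

/-!
# The interacting and the free `d`-wave pair susceptibilities of the torus agree up to `O(|U|)` at fixed temperature

Topic `MathematicalPhysics/QuantumLattice`; continuation of `DWaveSourceTorusSourcePowerSeries` /
`DWaveSourceTorusComplexSourceDisc` (fixed temperature). The Kubo–Mori–Bogoliubov `d`-wave pair susceptibility of
the sourced torus Gibbs state,

`χ_L(β; U, μ, t) = (β/L²) [Re (Q,Q)_{β,H_t} - (Re⟨Q⟩_{β,H_t})²]`, `H_t = dWaveSourceTorus L U μ t`, `Q = Δ_d + Δ_d†`,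

(`(·,·)` the Duhamel two-point function) is `(βL²)⁻¹ ∂²_t log Z_L(U,t)` (Dyson–Lieb–Simon; tree:
`hasDerivAt_re_gibbsState_source`, and `d/dt log Z = β Re⟨Q⟩` re-derived inside the proof). By the source power series
`log Z_L(U,t) = log Z₀' + Re Σ_m a_m(L;U) t^m` (`|t| ≤ δ`) with `‖a_m(L;U) - a_m(L;0)‖ ≤ (3/2)L²Aϱ^{m+1}|U|`, the
difference `Σ_m (a_m(U) - a_m(0)) z^m` is holomorphic and `O(L²|U|)` on the complex disc `‖z‖ < 2δ`, so by two Cauchy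
estimates its second derivative is `O(L²|U|)` on `|t| < δ`. Hence
(`dWaveSourceTorus_susceptibilitySlack_fixedT`): for `β > 0`, `μ` there are `δ > 0`, `K ≥ 0` with

`|χ_L(β; U, μ, t) - χ_L(β; 0, μ, t)| ≤ K |U|`  for all `L ≥ 3`, `|U| ≤ δ`, `|t| ≤ δ`

— written in the integrand of hypothesis (A_χ) of `HubbardSuperconductivity/ThermalWedge`
(`stub_engineDiscSlack_of_susceptibilitySlack`): the interaction correction to the pair susceptibility is `O(|U|)`
throughout a source disc, uniformly in the volume, at FIXED temperature (`δ, K` depend on `β`; the route's window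
`β ≤ e^{a/U}` with `η log β + K` slack is the multiscale statement and is NOT asserted here).
Everything is PROVED; no definition and no named fact.

## References
* F. J. Dyson, E. H. Lieb, B. Simon, J. Stat. Phys. 18 (1978) 335–383, §3 eq. (5). [cite: DLS1978, §3 eq. (5)]
* D. Ruelle, *Statistical Mechanics: Rigorous Results* (1969), §4.4. [cite: Ruelle1969, §4.4]
* E. C. Titchmarsh, *The Theory of Functions*, 2nd ed. (1939), §2.5 (Cauchy's inequality). [cite: Titchmarsh1939, §2.5]
-/

noncomputable section

open scoped Matrix Matrix.Norms.L2Operator ComplexOrder Nat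
open Complex Filter Topology Set Metric Matrix
open Literature.Probability.LatticeModels

namespace Literature.MathematicalPhysics.QuantumLattice

/-! ### Cauchy estimates on a disc -/

section Cauchy

variable {f : ℂ → ℂ} {R S ρ : ℝ} {w : ℂ}

/-- **Cauchy's inequality**: if `f` is holomorphic and bounded by `S` on `‖z‖ < R`, then `‖f'(w)‖ ≤ S/ρ` whenever
`‖w‖ + ρ < R`, `ρ > 0`. [cite: Titchmarsh1939, §2.5] -/
theorem norm_deriv_le_of_forall_mem_ball_norm_le (hf : DifferentiableOn ℂ f (ball (0 : ℂ) R))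
    (hS : ∀ z ∈ ball (0 : ℂ) R, ‖f z‖ ≤ S) (hρ : 0 < ρ) (hw : ‖w‖ + ρ < R) : ‖deriv f w‖ ≤ S / ρ := by
  have hsub : closedBall w ρ ⊆ ball (0 : ℂ) R := fun z hz => by
    rw [mem_closedBall, dist_eq_norm] at hz
    rw [mem_ball_zero_iff]
    calc ‖z‖ = ‖(z - w) + w‖ := by rw [sub_add_cancel]
      _ ≤ ‖z - w‖ + ‖w‖ := norm_add_le _ _
      _ < R := by linarith
  have hdc : DiffContOnCl ℂ f (ball w ρ) := by
    refine DifferentiableOn.diffContOnCl ?_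
    rw [closure_ball w hρ.ne']
    exact hf.mono hsub
  exact Complex.norm_deriv_le_of_forall_mem_sphere_norm_le hρ hdc
    (fun z hz => hS z (hsub (sphere_subset_closedBall hz)))

/-- **Cauchy's inequality for the second derivative**: `‖f''(w)‖ ≤ S/ρ²` whenever `‖w‖ + 2ρ < R`.
[cite: Titchmarsh1939, §2.5] -/
theorem norm_deriv_deriv_le_of_forall_mem_ball_norm_le (hf : DifferentiableOn ℂ f (ball (0 : ℂ) R))
    (hS : ∀ z ∈ ball (0 : ℂ) R, ‖f z‖ ≤ S) (hρ : 0 < ρ) (hw : ‖w‖ + 2 * ρ < R) :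
    ‖deriv (deriv f) w‖ ≤ S / ρ ^ 2 := by
  have hg : DifferentiableOn ℂ (deriv f) (ball (0 : ℂ) R) :=
    ((hf.analyticOnNhd isOpen_ball).deriv).differentiableOn
  have hgS : ∀ z ∈ ball (0 : ℂ) (R - ρ), ‖deriv f z‖ ≤ S / ρ := fun z hz =>
    norm_deriv_le_of_forall_mem_ball_norm_le hf hS hρ (by rw [mem_ball_zero_iff] at hz; linarith)
  have key := norm_deriv_le_of_forall_mem_ball_norm_le (hg.mono (ball_subset_ball (by linarith))) hgS hρ
    (by linarith : ‖w‖ + ρ < R - ρ)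
  rw [div_div, ← sq] at key
  exact key

end Cauchy

/-! ### The sourced torus: the susceptibility slack at fixed temperature -/

section Model

variable (β μ : ℝ)

/-- **The interaction correction to the KMB `d`-wave pair susceptibility is `O(|U|)` on a source disc, at fixed
temperature, uniformly in the volume.** For `β > 0`, `μ` there are `δ > 0`, `K ≥ 0` such that for all `L ≥ 3` and
real `|U| ≤ δ`, `|t| ≤ δ`:
`|(β/L²)[Re (Q,Q)_{H_U,t} - (Re⟨Q⟩_{H_U,t})²] - (β/L²)[Re (Q,Q)_{H_0,t} - (Re⟨Q⟩_{H_0,t})²]| ≤ K|U|`,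
`H_{U,t} = dWaveSourceTorus L U μ t`, `Q = Δ_d + Δ_d†`. [cite: DLS1978, §3 eq. (5)] -/
theorem dWaveSourceTorus_susceptibilitySlack_fixedT (hβ : 0 < β) :
    ∃ δ : ℝ, 0 < δ ∧ ∃ K : ℝ, 0 ≤ K ∧ ∀ (L : ℕ) [NeZero L], 3 ≤ L → ∀ U : ℝ, |U| ≤ δ → ∀ t : ℝ, |t| ≤ δ →
      |β / (L : ℝ) ^ 2 *
            ((Matrix.duhamel β (dWaveSourceTorus L U μ t)
                (pairField dWaveFormFactor L + (pairField dWaveFormFactor L)ᴴ)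
                (pairField dWaveFormFactor L + (pairField dWaveFormFactor L)ᴴ)).re -
              (Matrix.gibbsState β (dWaveSourceTorus L U μ t)
                (pairField dWaveFormFactor L + (pairField dWaveFormFactor L)ᴴ)).re ^ 2) -
          β / (L : ℝ) ^ 2 *
            ((Matrix.duhamel β (dWaveSourceTorus L 0 μ t)
                (pairField dWaveFormFactor L + (pairField dWaveFormFactor L)ᴴ)
                (pairField dWaveFormFactor L + (pairField dWaveFormFactor L)ᴴ)).re -
              (Matrix.gibbsState β (dWaveSourceTorus L 0 μ t)
                (pairField dWaveFormFactor L + (pairField dWaveFormFactor L)ᴴ)).re ^ 2)| ≤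
        K * |U| := by
  obtain ⟨δ, hδ, ϱ, hϱ, hϱδ, A, hA, hmain⟩ := dWaveSourceTorus_partitionFn_eq_exp_sourcePowerSeries β μ hβ.le
  refine ⟨δ / 2, by positivity, 18 * A * ϱ / (β * δ ^ 2), by positivity, ?_⟩
  intro L _ hL U hU t ht
  have hUδ : |U| ≤ δ := by linarith
  have htδ : |t| < δ := by linarith
  have h0δ : |(0 : ℝ)| ≤ δ := by rw [abs_zero]; exact hδ.le
  obtain ⟨Z₀, hZ₀, a, hbound, hdiff, hrep⟩ := hmain L hL
  set Q := pairField dWaveFormFactor L + (pairField dWaveFormFactor L)ᴴ with hQ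
  have hQh : Q.IsHermitian := isHermitian_pairField_add_conjTranspose L
  set B : ℝ := (L : ℝ) ^ 2 * A with hB
  have hB0 : 0 ≤ B := by positivity
  have h2δ : ϱ * (2 * δ) < 1 := by nlinarith
  have hL0 : (0 : ℝ) < (L : ℝ) := Nat.cast_pos.2 (Nat.pos_of_ne_zero (NeZero.ne L))
  have hL2 : (0 : ℝ) < (L : ℝ) ^ 2 := by positivity
  -- real points of the source interval sit in the complex disc of radius `2δ`
  have hreal_ball : ∀ s : ℝ, |s| < δ → ((s : ℂ) ∈ ball (0 : ℂ) (2 * δ)) := fun s hs => by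
    rw [mem_ball_zero_iff, Complex.norm_real, Real.norm_eq_abs]; linarith
  -- per `U'`: the KMB variance is `β⁻² Re T_{U'}''` on `|s| < δ`, `T_{U'}(z) = Σ a_m(U') z^m`
  have perU : ∀ U' : ℝ, |U'| ≤ δ → ∀ s : ℝ, |s| < δ →
      (duhamel β (dWaveSourceTorus L U' μ s) Q Q).re - (gibbsState β (dWaveSourceTorus L U' μ s) Q).re ^ 2 =
        (deriv (deriv (fun z : ℂ => ∑' m, a U' m * z ^ m)) (s : ℂ)).re / β ^ 2 := by
    intro U' hU' s hs
    set H := hubbardTorusWith 2 L 1 U' μ with hH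
    have hHh : H.IsHermitian := isHermitian_hamiltonianWith (fermionTorusGraph 2 L) 1 U' μ
    have hHs : ∀ x : ℝ, dWaveSourceTorus L U' μ x = H - (x : ℂ) • Q := fun x => rfl
    set T : ℂ → ℂ := fun z => ∑' m, a U' m * z ^ m with hT
    have hM : 0 ≤ 3 / 2 * B := by positivity
    have hTd : DifferentiableOn ℂ T (ball (0 : ℂ) (2 * δ)) :=
      differentiableOn_tsum_mul_pow hM hϱ.le (hbound U' hU') (by positivity) h2δ
    have hTa : AnalyticOnNhd ℂ T (ball (0 : ℂ) (2 * δ)) := hTd.analyticOnNhd isOpen_ball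
    have hT'a : AnalyticOnNhd ℂ (deriv T) (ball (0 : ℂ) (2 * δ)) := hTa.deriv
    -- the real functions and their derivatives
    set F : ℝ → ℝ := fun x => Real.log (partitionFn β (H - (x : ℂ) • Q)).re with hF
    set G : ℝ → ℝ := fun x => Real.log Z₀ + (T (x : ℂ)).re with hG
    set mg : ℝ → ℝ := fun x => (gibbsState β (H - (x : ℂ) • Q) Q).re with hmg
    have hFG : ∀ x : ℝ, |x| ≤ δ → F x = G x := by
      intro x hx
      obtain ⟨-, hZ⟩ := hrep U' x hU' hx
      have hZpos : 0 < partitionFn β (dWaveSourceTorus L U' μ x) :=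
        Matrix.partitionFn_pos β (dWaveSourceTorus_isHermitian L hHh x)
      have hcpos : (0 : ℂ) < (Z₀ : ℂ) := by exact_mod_cast hZ₀
      have key := log_re_eq_of_eq_mul_exp hZpos hcpos hZ
      rw [Complex.ofReal_re] at key
      simp only [hF, hG, ← hHs]
      exact key
    -- `d/dx log Z_β(H - xQ) = β Re⟨Q⟩_{H - xQ}` (Dyson–Lieb–Simon; as in the route's
    -- `hasDerivAt_log_partitionFn_source`, re-derived here from `hasDerivAt_re_trace_exp_add_smul`)
    have h1 : ∀ x : ℝ, HasDerivAt F (β * mg x) x := by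
      intro x
      have hβ0 : β ≠ 0 := hβ.ne'
      set 𝔄 : Matrix _ _ ℂ := -(β : ℂ) • H with h𝔄
      set Y : Matrix _ _ ℂ := (β : ℂ) • Q with hY
      set Zr : ℝ → ℝ := fun y => (NormedSpace.exp (𝔄 + y • Y)).trace.re with hZrdef
      set N : ℝ → ℝ := fun y => (Y * NormedSpace.exp (𝔄 + y • Y)).trace.re with hNdef
      have hHt : ∀ y : ℝ, (H - (y : ℂ) • Q).IsHermitian := fun y => isHermitian_sub_smul hHh hQh y
      have hgW : ∀ y : ℝ, gibbsWeight β (H - (y : ℂ) • Q) = NormedSpace.exp (𝔄 + y • Y) := fun y =>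
        gibbsWeight_sub_smul β H Q y
      have hZt : ∀ y : ℝ, Zr y = (partitionFn β (H - (y : ℂ) • Q)).re := by
        intro y
        simp only [hZrdef, partitionFn, hgW]
      have hZpos : ∀ y, 0 < Zr y := fun y => by rw [hZt]; exact partitionFn_re_pos (hHt y) β
      have hm : ∀ y : ℝ, mg y = β⁻¹ * (N y / Zr y) := by
        intro y
        have hZc : partitionFn β (H - (y : ℂ) • Q) = ((Zr y : ℝ) : ℂ) := by
          rw [hZt]; exact partitionFn_eq_re (hHt y) β
        have hN : N y = β * (Q * NormedSpace.exp (𝔄 + y • Y)).trace.re := by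
          simp only [hNdef, hY, Matrix.smul_mul, trace_smul, smul_eq_mul, Complex.re_ofReal_mul]
        simp only [hmg]
        rw [gibbsState_apply, hZc, ← Complex.ofReal_inv, Complex.re_ofReal_mul, trace_mul_comm, hgW, hN]
        field_simp
      have hZ' : HasDerivAt Zr (N x) x := hasDerivAt_re_trace_exp_add_smul 𝔄 Y x
      have hlog : HasDerivAt (fun y => Real.log (Zr y)) (N x / Zr x) x := hZ'.log (hZpos x).ne'
      have hfun : F = fun y => Real.log (Zr y) := funext fun y => by simp only [hF, hZt]
      rw [hfun]
      refine hlog.congr_deriv ?_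
      rw [hm x]
      field_simp
    have h2 : ∀ x : ℝ, HasDerivAt mg (β * ((duhamel β (H - (x : ℂ) • Q) Q Q).re - mg x ^ 2)) x := fun x =>
      hasDerivAt_re_gibbsState_source hHh hQh hβ x
    have hT1 : ∀ x : ℝ, |x| < δ → HasDerivAt (fun y : ℝ => (T (y : ℂ)).re) ((deriv T (x : ℂ)).re) x := by
      intro x hx
      have hd : HasDerivAt T (deriv T (x : ℂ)) (x : ℂ) := ((hTa _ (hreal_ball x hx)).differentiableAt).hasDerivAt
      exact hd.real_of_complex
    have hT2 : ∀ x : ℝ, |x| < δ →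
        HasDerivAt (fun y : ℝ => (deriv T (y : ℂ)).re) ((deriv (deriv T) (x : ℂ)).re) x := by
      intro x hx
      have hd : HasDerivAt (deriv T) (deriv (deriv T) (x : ℂ)) (x : ℂ) :=
        ((hT'a _ (hreal_ball x hx)).differentiableAt).hasDerivAt
      exact hd.real_of_complex
    -- the open real interval `|x| < δ` is a neighbourhood of each of its points
    have hnhds : ∀ x : ℝ, |x| < δ → ∀ᶠ y in 𝓝 x, |y| < δ := fun x hx =>
      (isOpen_lt continuous_abs continuous_const).mem_nhds hx
    -- first identification: `β m = Re T'`
    have eq1 : ∀ x : ℝ, |x| < δ → β * mg x = (deriv T (x : ℂ)).re := by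
      intro x hx
      have hGd : HasDerivAt G ((deriv T (x : ℂ)).re) x := by
        have := (hT1 x hx).const_add (Real.log Z₀)
        simpa only [hG] using this
      have hFd : HasDerivAt F ((deriv T (x : ℂ)).re) x := by
        refine hGd.congr_of_eventuallyEq ?_
        filter_upwards [hnhds x hx] with y hy
        exact hFG y hy.le
      exact (h1 x).unique hFd
    -- second identification: `β V = β⁻¹ Re T''`
    have eq2 : ∀ x : ℝ, |x| < δ →
        β * ((duhamel β (H - (x : ℂ) • Q) Q Q).re - mg x ^ 2) = β⁻¹ * (deriv (deriv T) (x : ℂ)).re := by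
      intro x hx
      have hRd : HasDerivAt (fun y : ℝ => β⁻¹ * (deriv T (y : ℂ)).re) (β⁻¹ * (deriv (deriv T) (x : ℂ)).re) x :=
        (hT2 x hx).const_mul β⁻¹
      have hmd : HasDerivAt mg (β⁻¹ * (deriv (deriv T) (x : ℂ)).re) x := by
        refine hRd.congr_of_eventuallyEq ?_
        filter_upwards [hnhds x hx] with y hy
        show mg y = β⁻¹ * (deriv T (y : ℂ)).re
        rw [← eq1 y hy]
        field_simp
      exact (h2 x).unique hmd
    have key := eq2 s hs
    rw [hHs s]
    simp only [hmg] at key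
    field_simp at key ⊢
    linarith [key]
  -- the difference series `D(z) = Σ (a_m(U) - a_m(0)) z^m`: holomorphic and `O(|U|)` on `‖z‖ < 2δ`
  set d : ℕ → ℂ := fun m => a U m - a 0 m with hd
  have hdb : ∀ m, ‖d m‖ ≤ 3 / 2 * B * ϱ * |U| * ϱ ^ m := by
    intro m
    calc ‖d m‖ ≤ 3 / 2 * ((L : ℝ) ^ 2 * A) * ϱ ^ (m + 1) * |U| := hdiff U hUδ m
      _ = 3 / 2 * B * ϱ * |U| * ϱ ^ m := by rw [hB, pow_succ]; ring
  have hMd : 0 ≤ 3 / 2 * B * ϱ * |U| := by positivity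
  set D : ℂ → ℂ := fun z => ∑' m, d m * z ^ m with hD
  have hDd : DifferentiableOn ℂ D (ball (0 : ℂ) (2 * δ)) :=
    differentiableOn_tsum_mul_pow hMd hϱ.le hdb (by positivity) h2δ
  have hDS : ∀ z ∈ ball (0 : ℂ) (2 * δ), ‖D z‖ ≤ 9 / 2 * B * ϱ * |U| := by
    intro z hz
    rw [mem_ball_zero_iff] at hz
    have hz1 : ϱ * ‖z‖ < 1 := by nlinarith [norm_nonneg z]
    have hz3 : 1 / 3 ≤ 1 - ϱ * ‖z‖ := by nlinarith [norm_nonneg z]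
    calc ‖D z‖ ≤ 3 / 2 * B * ϱ * |U| / (1 - ϱ * ‖z‖) := (norm_tsum_mul_pow_le hϱ.le hdb hz1).2
      _ ≤ 3 / 2 * B * ϱ * |U| / (1 / 3) := div_le_div_of_nonneg_left hMd (by norm_num) hz3
      _ = 9 / 2 * B * ϱ * |U| := by ring
  have hD2 : ‖deriv (deriv D) (t : ℂ)‖ ≤ 9 / 2 * B * ϱ * |U| / (δ / 2) ^ 2 :=
    norm_deriv_deriv_le_of_forall_mem_ball_norm_le hDd hDS (by positivity)
      (by rw [Complex.norm_real, Real.norm_eq_abs]; linarith)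
  -- `D = T_U - T_0` on the disc, hence the same for the second derivatives
  set TU : ℂ → ℂ := fun z => ∑' m, a U m * z ^ m with hTU
  set T0 : ℂ → ℂ := fun z => ∑' m, a 0 m * z ^ m with hT0
  have hMB : 0 ≤ 3 / 2 * B := by positivity
  have hTUa : AnalyticOnNhd ℂ TU (ball (0 : ℂ) (2 * δ)) :=
    (differentiableOn_tsum_mul_pow hMB hϱ.le (hbound U hUδ) (by positivity) h2δ).analyticOnNhd isOpen_ball
  have hT0a : AnalyticOnNhd ℂ T0 (ball (0 : ℂ) (2 * δ)) :=
    (differentiableOn_tsum_mul_pow hMB hϱ.le (hbound 0 h0δ) (by positivity) h2δ).analyticOnNhd isOpen_ball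
  have hDeq : ∀ z ∈ ball (0 : ℂ) (2 * δ), D z = TU z - T0 z := by
    intro z hz
    rw [mem_ball_zero_iff] at hz
    have hz1 : ϱ * ‖z‖ < 1 := by nlinarith [norm_nonneg z]
    have hsU := (norm_tsum_mul_pow_le hϱ.le (hbound U hUδ) hz1).1
    have hs0 := (norm_tsum_mul_pow_le hϱ.le (hbound 0 h0δ) hz1).1
    simp only [hD, hTU, hT0, hd]
    rw [← (Summable.of_norm hsU).tsum_sub (Summable.of_norm hs0)]
    exact tsum_congr fun m => by ring
  have hD1 : ∀ w ∈ ball (0 : ℂ) (2 * δ), deriv D w = deriv TU w - deriv T0 w := by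
    intro w hw
    have hev : D =ᶠ[𝓝 w] fun z => TU z - T0 z := by
      filter_upwards [isOpen_ball.mem_nhds hw] with z hz
      exact hDeq z hz
    rw [hev.deriv_eq]
    exact deriv_sub (hTUa w hw).differentiableAt (hT0a w hw).differentiableAt
  have hD2eq : ∀ w ∈ ball (0 : ℂ) (2 * δ), deriv (deriv D) w = deriv (deriv TU) w - deriv (deriv T0) w := by
    intro w hw
    have hev : deriv D =ᶠ[𝓝 w] fun z => deriv TU z - deriv T0 z := by
      filter_upwards [isOpen_ball.mem_nhds hw] with z hz
      exact hD1 z hz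
    rw [hev.deriv_eq]
    exact deriv_sub (hTUa.deriv w hw).differentiableAt (hT0a.deriv w hw).differentiableAt
  -- assemble
  have hVU := perU U hUδ t htδ
  have hV0 := perU 0 h0δ t htδ
  have htball := hreal_ball t htδ
  rw [← mul_sub, hVU, hV0, ← sub_div, ← Complex.sub_re, ← hD2eq _ htball, abs_mul,
    abs_of_pos (by positivity : 0 < β / (L : ℝ) ^ 2), abs_div, abs_of_pos (by positivity : 0 < β ^ 2)]
  have hre : |(deriv (deriv D) (t : ℂ)).re| ≤ 9 / 2 * B * ϱ * |U| / (δ / 2) ^ 2 :=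
    (Complex.abs_re_le_norm _).trans hD2
  calc β / (L : ℝ) ^ 2 * (|(deriv (deriv D) (t : ℂ)).re| / β ^ 2)
      ≤ β / (L : ℝ) ^ 2 * (9 / 2 * B * ϱ * |U| / (δ / 2) ^ 2 / β ^ 2) := by gcongr
    _ = 18 * A * ϱ / (β * δ ^ 2) * |U| := by
        rw [hB]
        field_simp
        ring

end Model

end Literature.MathematicalPhysics.QuantumLattice
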